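import Mathlib

/-!
# Plane cone inequalities — the load-bearing steps of the `plane-iv0` certificate format

Seat `hubbard-upper-certfmt-1` (cell sr-mbsolver, crew (3) hubbard-upper; format file
`HOME/hubbard-upper-certfmt-1/FORMAT-plane-iv0.md` §4). HONEST FRAMING: first certified bounds; not a
superconductivity verdict; these are generic linear-algebra lemmas (no statement about the Hubbard model's
numbers). They are the inequalities on which the soundness theorem of a finite-light-cone PLANE certificate
rests (isometric column channels `Φ(X) = V†(X ⊗ 1)V`, cone enclosures, Cesàro re-indexing):

* `coneRange_posSemidef` (RANGE / nesting): if `V` is an isometry (`Vᴴ V = 1`) and `c • 1 - X ⪰ 0`, then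
  `c • 1 - Vᴴ X V ⪰ 0` — one Heisenberg column step `Φ(X) = V†(X ⊗ 1)V` cannot raise `λ_max`
  (and, applied to `X - c • 1 ⪰ 0`, cannot lower `λ_min`): the cone enclosures are NESTED in the depth `k`;
  `re_dotProduct_mulVec_le` : for a unit vector `ψ`, `Re⟨ψ, X ψ⟩ ≤ c` whenever `c • 1 - X ⪰ 0` — the
  numerical-range step `Tr[ρ h] ≤ λ_max(h)` for pure states (mixed states by convexity).
* `coneTransport_trace` (TRANSPORT): `Tr[(VρVᴴ)Y] = Tr[ρ(VᴴYV)]`; `kroneckerOne_range_posSemidef`: an enclosure of `X`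
  is one of `X ⊗ 1`; `unitaryConj_range_posSemidef_iff` (P-TRIM): unitary conjugation keeps enclosures.
* `nestedCone_posSemidef` ((P-NEST) two-level certificate, v0.3): `Vᴴ V = 1`, `c • 1 - X - ∑ Q i ⪰ 0` and
  `Vᴴ (Q i) V - μ i • 1 ⪰ 0` for all `i` give `(c - ∑ μ i) • 1 - Vᴴ X V ⪰ 0` — transport of an OPERATOR-valued slack.
* `gaugedSum_posSemidef` ((P-GAUGE) zero-sum gauges, v0.4): `∑ Z i = 0` and `c i • 1 - H i - Z i ⪰ 0` for all `i`
  give `(∑ c i) • 1 - ∑ H i ⪰ 0`; `pairGauge_sum_eq_zero`: pairwise `+z`·`-z` gauges sum to zero; `gaugedNestedCone_posSemidef`.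
* `nestedCone_lower_posSemidef` (MULTI-LEVEL nests, v0.5): the recursion step — a transported part `T` certified
  modulo next-level slack operators, `T - μ • 1 - ∑ Q i ⪰ 0`, with `Vᴴ (Q i) V - μ' i • 1 ⪰ 0`, gives
  `Vᴴ T V - (μ + ∑ μ' i) • 1 ⪰ 0` (effective lower claim `μ_eff`); `unitaryConj_range_posSemidef_lower_iff` (N2-TRIM).
* `sum_le_of_coneGroup_bound` (CESÀRO re-indexing): if every slice `j < A` obeys the cone-group bound
  `Σ_{k ≤ K} q k · e (j + k) ≤ λ` with weights `Σ q = 1` and `|e i| ≤ B`, then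
  `Σ_{j < A} e j ≤ A·λ + 2·K·B·Σ|q k|` — the polynomial weights only cost an `A`-independent end term.
-/

open Matrix BigOperators Finset
open scoped ComplexOrder

namespace Summit.Ventures.CertifiedManyBodySolver.Upper.PlaneConeIneq

section Range

variable {m n : Type*} [Fintype m] [Fintype n] [DecidableEq m] [DecidableEq n]

/-- **Range nesting under an isometry.** If `Vᴴ * V = 1` and `c • 1 - X` is positive semidefinite, then so is
`c • 1 - Vᴴ * X * V` (because it equals `Vᴴ * (c • 1 - X) * V`). -/
theorem coneRange_posSemidef (V : Matrix m n ℂ) (hV : Vᴴ * V = 1) (X : Matrix m m ℂ) (c : ℂ)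
    (hX : (c • (1 : Matrix m m ℂ) - X).PosSemidef) :
    (c • (1 : Matrix n n ℂ) - Vᴴ * X * V).PosSemidef := by
  have key : c • (1 : Matrix n n ℂ) - Vᴴ * X * V = Vᴴ * (c • (1 : Matrix m m ℂ) - X) * V := by
    rw [Matrix.mul_sub, Matrix.sub_mul, Matrix.mul_smul, Matrix.mul_one, Matrix.smul_mul, hV]
  rw [key]
  exact hX.conjTranspose_mul_mul_same V

/-- **Lower end.** Symmetrically, `X - c • 1 ⪰ 0` gives `Vᴴ * X * V - c • 1 ⪰ 0`. -/
theorem coneRange_posSemidef_lower (V : Matrix m n ℂ) (hV : Vᴴ * V = 1) (X : Matrix m m ℂ) (c : ℂ)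
    (hX : (X - c • (1 : Matrix m m ℂ)).PosSemidef) :
    (Vᴴ * X * V - c • (1 : Matrix n n ℂ)).PosSemidef := by
  have key : Vᴴ * X * V - c • (1 : Matrix n n ℂ) = Vᴴ * (X - c • (1 : Matrix m m ℂ)) * V := by
    rw [Matrix.mul_sub, Matrix.sub_mul, Matrix.mul_smul, Matrix.mul_one, Matrix.smul_mul, hV]
  rw [key]
  exact hX.conjTranspose_mul_mul_same V

/-- **Numerical range of a state.** If `c • 1 - X ⪰ 0` then every vector `ψ` has
`Re⟨ψ, X ψ⟩ ≤ Re(c) · ⟨ψ, ψ⟩` — for a unit vector, `Re⟨ψ, X ψ⟩ ≤ Re c`. -/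
theorem re_dotProduct_mulVec_le (X : Matrix m m ℂ) (c : ℂ)
    (hX : (c • (1 : Matrix m m ℂ) - X).PosSemidef) (ψ : m → ℂ) :
    (star ψ ⬝ᵥ (X *ᵥ ψ)).re ≤ (c * (star ψ ⬝ᵥ ψ)).re := by
  have h := hX.dotProduct_mulVec_nonneg ψ
  -- `0 ≤ star ψ ⬝ᵥ ((c • 1 - X) *ᵥ ψ)` in `ℂ` with the `ComplexOrder`
  have hre : 0 ≤ (star ψ ⬝ᵥ ((c • (1 : Matrix m m ℂ) - X) *ᵥ ψ)).re := (Complex.nonneg_iff.1 h).1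
  have hexp : star ψ ⬝ᵥ ((c • (1 : Matrix m m ℂ) - X) *ᵥ ψ) = c * (star ψ ⬝ᵥ ψ) - star ψ ⬝ᵥ (X *ᵥ ψ) := by
    rw [Matrix.sub_mulVec, dotProduct_sub, Matrix.smul_mulVec, Matrix.one_mulVec, dotProduct_smul,
      smul_eq_mul]
  rw [hexp, Complex.sub_re] at hre
  linarith

end Range

section Transport

variable {m n p : Type*} [Fintype m] [Fintype n] [Fintype p] [DecidableEq m] [DecidableEq n] [DecidableEq p]

open scoped Kronecker

omit [DecidableEq m] [DecidableEq n] in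
/-- **Transport (Heisenberg ↔ Schrödinger).** For any `ρ` on the input space, any `V` and any observable `Y` on the
output space, `Tr[(V ρ Vᴴ) Y] = Tr[ρ (Vᴴ Y V)]` — the column step moves from the state to the observable
(trace cyclicity; no isometry needed for the identity itself). -/
theorem coneTransport_trace (V : Matrix m n ℂ) (ρ : Matrix n n ℂ) (Y : Matrix m m ℂ) :
    Matrix.trace ((V * ρ * Vᴴ) * Y) = Matrix.trace (ρ * (Vᴴ * Y * V)) := by
  -- `Tr[V ρ Vᴴ Y] = Tr[Y V ρ Vᴴ] = Tr[Vᴴ Y V ρ] = Tr[ρ Vᴴ Y V]`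
  rw [Matrix.trace_mul_comm, ← Matrix.mul_assoc, ← Matrix.mul_assoc, Matrix.trace_mul_comm,
    ← Matrix.mul_assoc, ← Matrix.mul_assoc]
  exact Matrix.trace_mul_comm _ _

omit [Fintype m] [Fintype p] in
/-- `(c • 1 - X) ⊗ₖ 1 = c • 1 - X ⊗ₖ 1`. -/
theorem sub_kronecker_one (X : Matrix m m ℂ) (c : ℂ) :
    (c • (1 : Matrix m m ℂ) - X) ⊗ₖ (1 : Matrix p p ℂ) = c • (1 : Matrix (m × p) (m × p) ℂ) - X ⊗ₖ (1 : Matrix p p ℂ) := by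
  ext ⟨i, k⟩ ⟨j, l⟩
  simp only [Matrix.kroneckerMap_apply, Matrix.sub_apply, Matrix.smul_apply, Matrix.one_apply, smul_eq_mul,
    Prod.mk.injEq, sub_mul]
  by_cases h1 : i = j <;> by_cases h2 : k = l <;> simp [h1, h2]

/-- **Range of `X ⊗ 1`**: an enclosure of `X` is an enclosure of `X ⊗ 1` — the cone operator embedded into a
larger window (or tensored with the physical legs) keeps its `λ_max`. -/
theorem kroneckerOne_range_posSemidef (X : Matrix m m ℂ) (c : ℂ)
    (hX : (c • (1 : Matrix m m ℂ) - X).PosSemidef) :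
    (c • (1 : Matrix (m × p) (m × p) ℂ) - X ⊗ₖ (1 : Matrix p p ℂ)).PosSemidef := by
  rw [← sub_kronecker_one]
  exact hX.kronecker Matrix.PosSemidef.one

/-- **Trailing-unitary elision (P-TRIM).** Conjugation by a unitary `U` (both `Uᴴ U = 1` and `U Uᴴ = 1`) neither
raises nor lowers an enclosure: `c • 1 - X ⪰ 0 ↔ c • 1 - Uᴴ X U ⪰ 0`. So the gate layers applied LAST in the
Heisenberg cone may be dropped before the PSD test. -/
theorem unitaryConj_range_posSemidef_iff (U : Matrix m m ℂ) (hU : Uᴴ * U = 1) (hU' : U * Uᴴ = 1)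
    (X : Matrix m m ℂ) (c : ℂ) :
    (c • (1 : Matrix m m ℂ) - Uᴴ * X * U).PosSemidef ↔ (c • (1 : Matrix m m ℂ) - X).PosSemidef := by
  refine ⟨fun h => ?_, fun h => coneRange_posSemidef U hU X c h⟩
  have h2 := coneRange_posSemidef Uᴴ (by simpa using hU') (Uᴴ * X * U) c h
  have hX : Uᴴᴴ * (Uᴴ * X * U) * Uᴴ = X := by
    rw [Matrix.conjTranspose_conjTranspose]
    calc U * (Uᴴ * X * U) * Uᴴ = (U * Uᴴ) * X * (U * Uᴴ) := by
          simp only [Matrix.mul_assoc]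
      _ = X := by rw [hU', Matrix.one_mul, Matrix.mul_one]
  rwa [hX] at h2

end Transport

section Cesaro

/-- Shifting a window of length `A` by `k`: `Σ_{j<A} e (j + k) = Σ_{j<A} e j + (Σ_{i<k} e (A + i) - Σ_{i<k} e i)`. -/
theorem sum_range_shift (e : ℕ → ℝ) (A k : ℕ) :
    ∑ j ∈ range A, e (j + k) = ∑ j ∈ range A, e j + (∑ i ∈ range k, e (A + i) - ∑ i ∈ range k, e i) := by
  have h1 : ∑ x ∈ range (k + A), e x = ∑ x ∈ range k, e x + ∑ x ∈ range A, e (k + x) :=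
    Finset.sum_range_add e k A
  have h2 : ∑ x ∈ range (A + k), e x = ∑ x ∈ range A, e x + ∑ x ∈ range k, e (A + x) :=
    Finset.sum_range_add e A k
  have h3 : ∑ x ∈ range A, e (k + x) = ∑ j ∈ range A, e (j + k) := by
    refine Finset.sum_congr rfl fun x _ => ?_
    rw [Nat.add_comm]
  rw [Nat.add_comm k A] at h1
  linarith

/-- A window of `k ≤ K` terms of a `B`-bounded sequence has absolute sum `≤ K·B`. -/
theorem abs_sum_range_le (e : ℕ → ℝ) {B : ℝ} (hB : ∀ i, |e i| ≤ B) {k K : ℕ} (hk : k ≤ K) (s : ℕ) :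
    |∑ i ∈ range k, e (s + i)| ≤ K * B := by
  have hB0 : 0 ≤ B := (abs_nonneg _).trans (hB 0)
  calc |∑ i ∈ range k, e (s + i)| ≤ ∑ i ∈ range k, |e (s + i)| := Finset.abs_sum_le_sum_abs _ _
    _ ≤ ∑ _i ∈ range k, B := Finset.sum_le_sum fun i _ => hB _
    _ = k * B := by rw [Finset.sum_const, Finset.card_range, nsmul_eq_mul]
    _ ≤ K * B := mul_le_mul_of_nonneg_right (by exact_mod_cast hk) hB0

/-- **Cesàro re-indexing of a cone group.** Columns `j = 0, 1, …` of one slice class carry term values `e j`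
with `|e j| ≤ B`; a cone group with weights `q 0, …, q K`, `Σ q = 1`, certifies on every slice `j < A` the
bound `Σ_{k ≤ K} q k · e (j + k) ≤ λ`. Then the plain sum obeys `Σ_{j<A} e j ≤ A·λ + 2·K·B·Σ_{k ≤ K} |q k|`:
the weights re-assemble the plain sum up to `K` end terms per weight. -/
theorem sum_le_of_coneGroup_bound (e q : ℕ → ℝ) (K A : ℕ) (B lam : ℝ) (hB : ∀ i, |e i| ≤ B)
    (hq : ∑ k ∈ range (K + 1), q k = 1)
    (h : ∀ j, j < A → ∑ k ∈ range (K + 1), q k * e (j + k) ≤ lam) :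
    ∑ j ∈ range A, e j ≤ A * lam + 2 * K * B * ∑ k ∈ range (K + 1), |q k| := by
  set S : ℝ := ∑ j ∈ range A, e j with hS
  set d : ℕ → ℝ := fun k => ∑ i ∈ range k, e (A + i) - ∑ i ∈ range k, e i with hd
  -- (1) the slice bounds summed over `j < A`
  have h1 : ∑ j ∈ range A, ∑ k ∈ range (K + 1), q k * e (j + k) ≤ A * lam := by
    calc ∑ j ∈ range A, ∑ k ∈ range (K + 1), q k * e (j + k) ≤ ∑ _j ∈ range A, lam :=
          Finset.sum_le_sum fun j hj => h j (Finset.mem_range.1 hj)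
      _ = A * lam := by rw [Finset.sum_const, Finset.card_range, nsmul_eq_mul]
  -- (2) exchange the sums and shift each window
  have h2 : ∑ j ∈ range A, ∑ k ∈ range (K + 1), q k * e (j + k) = S + ∑ k ∈ range (K + 1), q k * d k := by
    rw [Finset.sum_comm]
    have : ∀ k ∈ range (K + 1), ∑ j ∈ range A, q k * e (j + k) = q k * S + q k * d k := by
      intro k _
      rw [← Finset.mul_sum, sum_range_shift e A k, mul_add]
    rw [Finset.sum_congr rfl this, Finset.sum_add_distrib, ← Finset.sum_mul, hq, one_mul]
  -- (3) the end terms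
  have h3 : |∑ k ∈ range (K + 1), q k * d k| ≤ 2 * K * B * ∑ k ∈ range (K + 1), |q k| := by
    calc |∑ k ∈ range (K + 1), q k * d k| ≤ ∑ k ∈ range (K + 1), |q k * d k| := Finset.abs_sum_le_sum_abs _ _
      _ ≤ ∑ k ∈ range (K + 1), |q k| * (2 * K * B) := by
          refine Finset.sum_le_sum fun k hk => ?_
          rw [abs_mul]
          refine mul_le_mul_of_nonneg_left ?_ (abs_nonneg _)
          have hkK : k ≤ K := Nat.lt_succ_iff.1 (Finset.mem_range.1 hk)
          have ha := abs_sum_range_le e hB hkK A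
          have hb := abs_sum_range_le e hB hkK 0
          have hb' : |∑ i ∈ range k, e i| ≤ K * B := by simpa using hb
          calc |d k| = |∑ i ∈ range k, e (A + i) - ∑ i ∈ range k, e i| := rfl
            _ ≤ |∑ i ∈ range k, e (A + i)| + |∑ i ∈ range k, e i| := abs_sub _ _
            _ ≤ K * B + K * B := add_le_add ha hb'
            _ = 2 * K * B := by ring
      _ = 2 * K * B * ∑ k ∈ range (K + 1), |q k| := by rw [← Finset.sum_mul]; ring
  have h4 : S = ∑ j ∈ range A, ∑ k ∈ range (K + 1), q k * e (j + k) - ∑ k ∈ range (K + 1), q k * d k := by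
    rw [h2]; ring
  have h5 := neg_abs_le (∑ k ∈ range (K + 1), q k * d k)
  rw [h4]
  linarith

/-- **Monomial weights need no Cesàro step**: with `q = δ_K` the hypothesis is `e j ≤ λ` for the columns
`K ≤ j < A` that have a full cone, the first `K` columns being bounded by `B` only:
`Σ_{j<A} e j ≤ A·λ + K·(B - λ)` (`= (A - K)·λ + K·B`). -/
theorem sum_le_of_monomial_bound (e : ℕ → ℝ) {K A : ℕ} (hKA : K ≤ A) (B lam : ℝ) (hB : ∀ i, |e i| ≤ B)
    (h : ∀ j, K ≤ j → j < A → e j ≤ lam) :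
    ∑ j ∈ range A, e j ≤ A * lam + K * (B - lam) := by
  obtain ⟨M, rfl⟩ := Nat.exists_eq_add_of_le hKA
  rw [Finset.sum_range_add]
  have h1 : ∑ x ∈ range K, e x ≤ K * B := by
    calc ∑ x ∈ range K, e x ≤ ∑ _x ∈ range K, B := Finset.sum_le_sum fun x _ => (abs_le.1 (hB x)).2
      _ = K * B := by rw [Finset.sum_const, Finset.card_range, nsmul_eq_mul]
  have h2 : ∑ x ∈ range M, e (K + x) ≤ M * lam := by
    calc ∑ x ∈ range M, e (K + x) ≤ ∑ _x ∈ range M, lam :=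
          Finset.sum_le_sum fun x hx => h (K + x) (Nat.le_add_right _ _) (by
            have := Finset.mem_range.1 hx; omega)
      _ = M * lam := by rw [Finset.sum_const, Finset.card_range, nsmul_eq_mul]
  push_cast
  linarith

end Cesaro

section Nested

variable {m n ι : Type*} [Fintype m] [Fintype n] [DecidableEq m] [DecidableEq n]

omit [Fintype n] [DecidableEq n] in
/-- A finite sum of positive semidefinite matrices is positive semidefinite. -/
theorem posSemidef_sum (s : Finset ι) (A : ι → Matrix n n ℂ) (hA : ∀ i ∈ s, (A i).PosSemidef) :
    (∑ i ∈ s, A i).PosSemidef := by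
  classical
  induction s using Finset.induction_on with
  | empty => simpa using Matrix.PosSemidef.zero
  | insert a s ha ih =>
    rw [Finset.sum_insert ha]
    exact (hA a (Finset.mem_insert_self a s)).add
      (ih fun i hi => hA i (Finset.mem_insert_of_mem hi))

/-- **(P-NEST) two-level (nested) cone certificate.** Let `V` be an isometry (`Vᴴ V = 1`; in the format:
the product of the placements of `k₂` further column steps, so that `X ↦ Vᴴ X V` is the transport `Φ^{k₂}`).
If at the shallow level the OPERATOR inequality `c • 1 - X - ∑ Q i ⪰ 0` is certified (one dense PSD test, the
`Q i` being producer-chosen local «slack» operators), and each transported slack operator is bounded below,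
`Vᴴ (Q i) V - μ i • 1 ⪰ 0` (one dense PSD test per `i`, each on the small cone of a local operator), then the deep
cone operator obeys `(c - ∑ μ i) • 1 - Vᴴ X V ⪰ 0`, i.e. `λ_max(Φ^{k₂}(X)) ≤ c - ∑ μ i`. Proof: conjugate the first
inequality by `V` (range nesting) and add the second family (a sum of PSD matrices is PSD). No property of the
`Q i` other than these two tests is used. -/
theorem nestedCone_posSemidef (V : Matrix m n ℂ) (hV : Vᴴ * V = 1) (X : Matrix m m ℂ) (s : Finset ι)
    (Q : ι → Matrix m m ℂ) (c : ℂ) (μ : ι → ℂ)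
    (h₁ : (c • (1 : Matrix m m ℂ) - X - ∑ i ∈ s, Q i).PosSemidef)
    (h₂ : ∀ i ∈ s, (Vᴴ * Q i * V - μ i • (1 : Matrix n n ℂ)).PosSemidef) :
    ((c - ∑ i ∈ s, μ i) • (1 : Matrix n n ℂ) - Vᴴ * X * V).PosSemidef := by
  have hT : (Vᴴ * (c • (1 : Matrix m m ℂ) - X - ∑ i ∈ s, Q i) * V).PosSemidef :=
    h₁.conjTranspose_mul_mul_same V
  have hexp : Vᴴ * (c • (1 : Matrix m m ℂ) - X - ∑ i ∈ s, Q i) * V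
      = c • (1 : Matrix n n ℂ) - Vᴴ * X * V - ∑ i ∈ s, Vᴴ * Q i * V := by
    rw [Matrix.mul_sub, Matrix.mul_sub, Matrix.sub_mul, Matrix.sub_mul, Matrix.mul_smul, Matrix.mul_one,
      Matrix.smul_mul, hV, Matrix.mul_sum, Matrix.sum_mul]
  rw [hexp] at hT
  have hS : (∑ i ∈ s, (Vᴴ * Q i * V - μ i • (1 : Matrix n n ℂ))).PosSemidef := posSemidef_sum s _ h₂
  have hsum := hT.add hS
  have halg : c • (1 : Matrix n n ℂ) - Vᴴ * X * V - ∑ i ∈ s, Vᴴ * Q i * V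
      + ∑ i ∈ s, (Vᴴ * Q i * V - μ i • (1 : Matrix n n ℂ))
      = (c - ∑ i ∈ s, μ i) • (1 : Matrix n n ℂ) - Vᴴ * X * V := by
    rw [Finset.sum_sub_distrib, ← Finset.sum_smul, sub_smul]
    abel
  rw [halg] at hsum
  exact hsum

/-- **(P-NEST), scalar form.** Under the hypotheses of `nestedCone_posSemidef`, every unit vector `ψ` has
`Re⟨ψ, Vᴴ X V ψ⟩ ≤ Re(c - ∑ μ i)` — the transported cone bound the verifier adds into `c⁺`. -/
theorem nestedCone_re_le (V : Matrix m n ℂ) (hV : Vᴴ * V = 1) (X : Matrix m m ℂ) (s : Finset ι)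
    (Q : ι → Matrix m m ℂ) (c : ℂ) (μ : ι → ℂ)
    (h₁ : (c • (1 : Matrix m m ℂ) - X - ∑ i ∈ s, Q i).PosSemidef)
    (h₂ : ∀ i ∈ s, (Vᴴ * Q i * V - μ i • (1 : Matrix n n ℂ)).PosSemidef) (ψ : n → ℂ) :
    (star ψ ⬝ᵥ ((Vᴴ * X * V) *ᵥ ψ)).re ≤ ((c - ∑ i ∈ s, μ i) * (star ψ ⬝ᵥ ψ)).re :=
  re_dotProduct_mulVec_le (Vᴴ * X * V) (c - ∑ i ∈ s, μ i) (nestedCone_posSemidef V hV X s Q c μ h₁ h₂) ψ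

end Nested

section Gauge

variable {n ι κ : Type*} [Fintype n] [DecidableEq n]

omit [Fintype n] in
/-- **(P-GAUGE) zero-sum gauges between cone groups** (FORMAT v0.4 §4 (G′), certfmt-2's gauge pairs). If the
gauge operators sum to zero, `∑ Z i = 0`, and every GAUGED group passes its upper test `c i • 1 - H i - Z i ⪰ 0`,
then the plain sum of the group operators obeys `(∑ c i) • 1 - ∑ H i ⪰ 0`: the gauges redistribute slack between
groups acting on the same state and cancel in the total. Proof: add the tests (a sum of PSD matrices is PSD) and
cancel `∑ Z i`. Nothing about the `Z i` other than the zero sum is used. -/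
theorem gaugedSum_posSemidef (s : Finset ι) (H Z : ι → Matrix n n ℂ) (c : ι → ℂ)
    (hZ : ∑ i ∈ s, Z i = 0) (h : ∀ i ∈ s, (c i • (1 : Matrix n n ℂ) - H i - Z i).PosSemidef) :
    ((∑ i ∈ s, c i) • (1 : Matrix n n ℂ) - ∑ i ∈ s, H i).PosSemidef := by
  have hS := posSemidef_sum s _ h
  have halg : ∑ i ∈ s, (c i • (1 : Matrix n n ℂ) - H i - Z i)
      = (∑ i ∈ s, c i) • (1 : Matrix n n ℂ) - ∑ i ∈ s, H i := by
    rw [Finset.sum_sub_distrib, Finset.sum_sub_distrib, hZ, sub_zero, Finset.sum_smul]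
  rw [halg] at hS
  exact hS

/-- **(P-GAUGE), scalar form.** Under the hypotheses of `gaugedSum_posSemidef`, every vector `ψ` has
`Re⟨ψ, (∑ H i) ψ⟩ ≤ Re((∑ c i) ⟨ψ, ψ⟩)` — the sum of the gauged group bounds is what enters `c⁺`. -/
theorem gaugedSum_re_le (s : Finset ι) (H Z : ι → Matrix n n ℂ) (c : ι → ℂ)
    (hZ : ∑ i ∈ s, Z i = 0) (h : ∀ i ∈ s, (c i • (1 : Matrix n n ℂ) - H i - Z i).PosSemidef) (ψ : n → ℂ) :
    (star ψ ⬝ᵥ ((∑ i ∈ s, H i) *ᵥ ψ)).re ≤ ((∑ i ∈ s, c i) * (star ψ ⬝ᵥ ψ)).re :=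
  re_dotProduct_mulVec_le (∑ i ∈ s, H i) (∑ i ∈ s, c i) (gaugedSum_posSemidef s H Z c hZ h) ψ

omit [Fintype n] [DecidableEq n] in
/-- **Gauge PAIRS sum to zero.** The format builds the gauges from pairs `p` of groups `(a p, b p)` carrying one
local operator `z p` each, entered as `+ z p` in group `a p` and `- z p` in group `b p`; if both ends of every
pair lie in the group set `s`, the resulting gauges `Z i = ∑_p ([a p = i] z p - [b p = i] z p)` satisfy
`∑_{i ∈ s} Z i = 0` identically — the hypothesis `hZ` of `gaugedSum_posSemidef`. -/
theorem pairGauge_sum_eq_zero [DecidableEq ι] (s : Finset ι) (P : Finset κ) (a b : κ → ι)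
    (z : κ → Matrix n n ℂ) (ha : ∀ p ∈ P, a p ∈ s) (hb : ∀ p ∈ P, b p ∈ s) :
    ∑ i ∈ s, ∑ p ∈ P, ((if a p = i then z p else 0) - (if b p = i then z p else 0)) = 0 := by
  rw [Finset.sum_comm]
  refine Finset.sum_eq_zero fun p hp => ?_
  rw [Finset.sum_sub_distrib, Finset.sum_ite_eq, Finset.sum_ite_eq, if_pos (ha p hp), if_pos (hb p hp),
    sub_self]

/-- **(P-GAUGE) + (P-NEST) combined** (a gauged group that also carries a nest, FORMAT v0.4 §4): if
`Vᴴ V = 1`, the shallow test is run on the gauged-and-nested operator, `c • 1 - X - Z - ∑ Q i ⪰ 0`, and each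
transported slack is bounded below, `Vᴴ (Q i) V - μ i • 1 ⪰ 0`, then
`(c - ∑ μ i) • 1 - Vᴴ (X + Z) V ⪰ 0` — i.e. the nest certifies the GAUGED operator `X + Z` at the deeper level,
and the gauges then cancel across groups by `gaugedSum_posSemidef` applied to the transported operators. -/
theorem gaugedNestedCone_posSemidef {m : Type*} [Fintype m] [DecidableEq m]
    (V : Matrix m n ℂ) (hV : Vᴴ * V = 1) (X Z : Matrix m m ℂ)
    (s : Finset ι) (Q : ι → Matrix m m ℂ) (c : ℂ) (μ : ι → ℂ)
    (h₁ : (c • (1 : Matrix m m ℂ) - X - Z - ∑ i ∈ s, Q i).PosSemidef)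
    (h₂ : ∀ i ∈ s, (Vᴴ * Q i * V - μ i • (1 : Matrix n n ℂ)).PosSemidef) :
    ((c - ∑ i ∈ s, μ i) • (1 : Matrix n n ℂ) - Vᴴ * (X + Z) * V).PosSemidef := by
  have h₁' : (c • (1 : Matrix m m ℂ) - (X + Z) - ∑ i ∈ s, Q i).PosSemidef := by
    have : c • (1 : Matrix m m ℂ) - (X + Z) - ∑ i ∈ s, Q i = c • (1 : Matrix m m ℂ) - X - Z - ∑ i ∈ s, Q i := by
      abel
    rw [this]; exact h₁
  exact nestedCone_posSemidef V hV (X + Z) s Q c μ h₁' h₂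

end Gauge

section NestedRec

variable {m n : Type*} [Fintype m] [Fintype n] [DecidableEq m] [DecidableEq n]

/-- **(P-TRIM) for LOWER claims (N2-TRIM, FORMAT v0.5).** Conjugation by a unitary `U` keeps lower enclosures
too: `X - c • 1 ⪰ 0 ↔ Uᴴ X U - c • 1 ⪰ 0`. So the deepest column's gate layers of a TRANSPORTED nest part (a
unitary conjugation of `T ⊗ 1`) may be elided before its PSD test, exactly as for the members' cones. -/
theorem unitaryConj_range_posSemidef_lower_iff (U : Matrix m m ℂ) (hU : Uᴴ * U = 1) (hU' : U * Uᴴ = 1)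
    (X : Matrix m m ℂ) (c : ℂ) :
    (Uᴴ * X * U - c • (1 : Matrix m m ℂ)).PosSemidef ↔ (X - c • (1 : Matrix m m ℂ)).PosSemidef := by
  have e1 : Uᴴ * X * U - c • (1 : Matrix m m ℂ) = (-c) • (1 : Matrix m m ℂ) - Uᴴ * (-X) * U := by
    rw [Matrix.mul_neg, Matrix.neg_mul, neg_smul, sub_neg_eq_add, neg_add_eq_sub]
  have e2 : X - c • (1 : Matrix m m ℂ) = (-c) • (1 : Matrix m m ℂ) - (-X) := by
    rw [neg_smul, sub_neg_eq_add, neg_add_eq_sub]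
  rw [e1, e2]
  exact unitaryConj_range_posSemidef_iff U hU hU' (-X) (-c)

/-- **(P-NEST) recursion step = MULTI-LEVEL nests (FORMAT v0.5).** A transported nest part `T` (whose LOWER claim
`μ` the verifier must certify) may itself be split: if `T - μ • 1 - ∑ Q i ⪰ 0` (one dense test on `T`'s window,
the `Q i` being the next level's slack operators) and every `Q i`, transported by the isometry `V` of the next
`k₃` column steps, is bounded below, `Vᴴ (Q i) V - μ' i • 1 ⪰ 0`, then `Vᴴ T V - (μ + ∑ μ' i) • 1 ⪰ 0`:
the part enters its parent level with the EFFECTIVE lower claim `μ_eff = μ + ∑ μ' i`. This is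
`nestedCone_posSemidef` applied to `-T` and `-μ`; iterating it level by level is the whole multi-level rule. -/
theorem nestedCone_lower_posSemidef {ι : Type*} (V : Matrix m n ℂ) (hV : Vᴴ * V = 1) (T : Matrix m m ℂ)
    (s : Finset ι) (Q : ι → Matrix m m ℂ) (μ : ℂ) (μ' : ι → ℂ)
    (h₁ : (T - μ • (1 : Matrix m m ℂ) - ∑ i ∈ s, Q i).PosSemidef)
    (h₂ : ∀ i ∈ s, (Vᴴ * Q i * V - μ' i • (1 : Matrix n n ℂ)).PosSemidef) :
    (Vᴴ * T * V - (μ + ∑ i ∈ s, μ' i) • (1 : Matrix n n ℂ)).PosSemidef := by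
  have h₁' : ((-μ) • (1 : Matrix m m ℂ) - (-T) - ∑ i ∈ s, Q i).PosSemidef := by
    have e : (-μ) • (1 : Matrix m m ℂ) - (-T) - ∑ i ∈ s, Q i = T - μ • (1 : Matrix m m ℂ) - ∑ i ∈ s, Q i := by
      rw [neg_smul, sub_neg_eq_add, neg_add_eq_sub]
    rw [e]; exact h₁
  have h := nestedCone_posSemidef V hV (-T) s Q (-μ) μ' h₁' h₂
  have e' : (-μ - ∑ i ∈ s, μ' i) • (1 : Matrix n n ℂ) - Vᴴ * (-T) * V
      = Vᴴ * T * V - (μ + ∑ i ∈ s, μ' i) • (1 : Matrix n n ℂ) := by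
    rw [Matrix.mul_neg, Matrix.neg_mul, sub_neg_eq_add, ← neg_add', neg_smul, neg_add_eq_sub]
  rw [e'] at h
  exact h

/-- **Multi-level nest, scalar form.** Under the hypotheses of `nestedCone_lower_posSemidef`, every vector `ψ`
on the deeper frame has `Re((μ + ∑ μ' i) · ⟨ψ, ψ⟩) ≤ Re⟨ψ, Vᴴ T V ψ⟩` — the effective lower claim `μ_eff` that the
verifier carries up to the parent level in place of `μ`. -/
theorem nestedCone_lower_re_le {ι : Type*} (V : Matrix m n ℂ) (hV : Vᴴ * V = 1) (T : Matrix m m ℂ)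
    (s : Finset ι) (Q : ι → Matrix m m ℂ) (μ : ℂ) (μ' : ι → ℂ)
    (h₁ : (T - μ • (1 : Matrix m m ℂ) - ∑ i ∈ s, Q i).PosSemidef)
    (h₂ : ∀ i ∈ s, (Vᴴ * Q i * V - μ' i • (1 : Matrix n n ℂ)).PosSemidef) (ψ : n → ℂ) :
    ((μ + ∑ i ∈ s, μ' i) * (star ψ ⬝ᵥ ψ)).re ≤ (star ψ ⬝ᵥ ((Vᴴ * T * V) *ᵥ ψ)).re := by
  have h := nestedCone_lower_posSemidef V hV T s Q μ μ' h₁ h₂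
  -- rewrite `VᴴTV - c•1 ⪰ 0` as `(-c)•1 - (-(VᴴTV)) ⪰ 0` and use the numerical-range lemma
  have h' : ((-(μ + ∑ i ∈ s, μ' i)) • (1 : Matrix n n ℂ) - (-(Vᴴ * T * V))).PosSemidef := by
    have e : (-(μ + ∑ i ∈ s, μ' i)) • (1 : Matrix n n ℂ) - (-(Vᴴ * T * V))
        = Vᴴ * T * V - (μ + ∑ i ∈ s, μ' i) • (1 : Matrix n n ℂ) := by
      rw [neg_smul, sub_neg_eq_add, neg_add_eq_sub]
    rw [e]; exact h
  have r := re_dotProduct_mulVec_le (-(Vᴴ * T * V)) (-(μ + ∑ i ∈ s, μ' i)) h' ψ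
  rw [Matrix.neg_mulVec, dotProduct_neg, Complex.neg_re, neg_mul, Complex.neg_re] at r
  linarith

end NestedRec

end Summit.Ventures.CertifiedManyBodySolver.Upper.PlaneConeIneq
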